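import Mathlib
import HarnessLib
import Literature.MathematicalPhysics.QuantumFieldTheory.Balaban1983to89.B13PerturbativeStep

/-!
# [Balaban1988RG2Cluster] (2.16) p. 16: the smallness of the complexified localised operators — the leaf G-B13-05a REDUCED TO PER-TERM
# statements: a family of σ-ANALYTIC walk terms with σ-UNIFORM entrywise majorants whose localised row sums are summable yields a
# σ-analytic, uniformly localised SUM, to which the tree's Cauchy step `B13PerturbativeStep.WRS.sub_apply_zero_of_differentiableOn`
# applies (cell topic `Summits/QuantumFields/BalabanUV/Beta/AnalyticWalkSum216`)

HONEST FRAMING (cell rule).  Discharging `BetaPertH` makes Bałaban's UV stability UNCONDITIONAL — a real constructive-QFT result; NOT the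
continuum limit, NOT the Clay problem.  This module discharges NOTHING of `BetaPertH`.  It is [folklore] one-variable complex analysis
(Weierstrass M-test + Cauchy) placed at the exact seam of terminal leaf (T1) of the row-D4 apex map (`BETA/REMAINDER-BETA.md` §9.1/§9.3;
cell GAPS G-B13-05a, b13-g5: *«the smallness of (2.16) itself … rests on (i) the localised random-walk expansions being ANALYTIC in (𝐔,𝐉,σ)
with (ii) localisation bounds UNIFORM on the complex domain … (iii) a Cauchy estimate»*; (iii) is KERNEL since C-B13-13a, `WRS.sub_apply_zero_
of_differentiableOn`, whose hypothesis is the SUMMED operator family `σ ↦ A σ`).  What a complexified [13] Sect. E / B10 (63) walk expansion —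
leaves (T2) G-IF-10 and (T3) G-B9-10 — would deliver is PER-TERM: each walk term analytic in σ with a σ-uniform (3.108)-type majorant.  This file
proves that the per-term data suffice: (i)+(ii) for the SUM follow, and the (2.16)-type bound with them.  So after this file (T1) = «per-walk-term
analyticity + σ-uniform (3.108)-type majorants with summable localised row sums» = exactly (T2)/(T3), nothing else.  Bookkeeping-grade; NOT summit
progress.  Unit `b2b-balaban-beta-an4-g32` (row D4 owner).

CITATION HEADER (lean-in-tree rule).  [II] = T. Bałaban, *Renormalization group approach to lattice gauge field theories. II. Cluster expansions*,
Commun. Math. Phys. **116**, 1–22 (1988) [Balaban1988RG2Cluster], p. 16 [PDF 16] (2.16)–(2.17) (render `HOME/b2b-balaban-ref1/pages/1988-cmp116-rg-II-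
cluster/1988-cmp116-rg-II-cluster-p016-x2.png`, READ AS IMAGE: (2.16) and (2.17) are printed on p. 16 — v1 said «p. 15», a locator slip inherited
from `B13PerturbativeStep`'s header, XREAD D1 of b2b-balaban-beta-an3-g24; the display is quoted verbatim there, imported, not re-quoted here)
and p. 13 [PDF 13] (render `…-p013-x2.png`, READ AS IMAGE by this seat 2026-08-20): *«For this class of localization domains we construct the
generalized random walk expansions. This construction was discussed in [13] for all operators determining Δ_k, and for C^{(k)}(Z₀), but not for
(C^{(k)})^{1/2}. … The operator G̃₃(x) has the same properties as G̃₂, especially it can be expanded into a generalized random walk expansion.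
This yields an expansion of the integral above, hence an expansion of (C^{(k)})^{1/2} also. Using these expansions we introduce the parameters
s, and we apply the»* [continuing p. 14 l. 1: «decomposition (1.10),» — Sect. 1's s-decoupling formula].  Nothing of [II] is asserted: the walk terms, their analyticity and their majorants are
HYPOTHESES (letters `T`, `m`), exactly the outputs the located leaves (T2)/(T3) owe.

WHAT THIS FILE PROVES ([folklore]; `n` a finite index type — bonds of a cube system —, `W` ANY index type of walks, `T : W → ℂ → Matrix n n ℂ`
the walk terms as functions of ONE complex parameter `σ` (several parameters are treated one complex line at a time, as in `B13PerturbativeStep`),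
`m : W → n → n → ℝ` σ-UNIFORM entrywise majorants on the disc `‖σ‖ < R`, summable in `w` entry by entry):
* §1 `termSum T σ i j := ∑' w, T w σ i j` (the summed operator, entrywise), `majSum m i j := ∑' w, m w i j`; `hasSum_termSum` (absolute
  convergence ⇒ the entrywise sums converge to `termSum`), `norm_termSum_le` (`‖termSum T σ i j‖ ≤ majSum m i j` — (ii) for the sum),
  **`differentiableOn_termSum`** ((i) for the sum: Mathlib's `Complex.differentiableOn_tsum_of_summable_norm`, the M-test);
* §2 **`wrs_termSum_sub`**: if moreover the summed majorant is LOCALISED, `Σ_j majSum m i j · e^{κ d(i,j)} ≤ ρ`, then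
  `WRS κ d (termSum T σ − termSum T 0) (2ρ/R·‖σ‖)` for `‖σ‖ < R` — the (2.16)-shape `O(|σ|/R)` bound at the full rate `κ` for the DIFFERENCE of
  the summed complexified operator and its value at `σ = 0` (`WRS.sub_apply_zero_of_differentiableOn` BY NAME); `wrs_termSum_zero`
  (`WRS κ d (termSum T 0) ρ`); and **`wrs_inv_termSum_sub`** — the «R₂ satisfying (2.16)» shape for the INVERSES
  (`WRS.inv_sub_inv_of_differentiableOn` BY NAME) under `IsUnit (termSum T 0)`, `WRS κ d (termSum T 0)⁻¹ K`, `K·(2ρ/R)|σ| < 1`;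
* §3 `majSum_row_le_of_termwise`: the localised row-sum hypothesis on `majSum` from TERMWISE localised row sums `Σ_j m w i j e^{κd} ≤ ρ_w`
  with `Σ_w ρ_w ≤ ρ` (interchange of the finite row sum with the `tsum`, monotonicity of `tsum`) — the form in which a walk expansion states its
  bounds ((3.108): one constant per walk, geometric in `|ω|`); `wrs_termSum_sub_of_termwise` packages §2 + §3.
v1.0.1 (DOCSTRING-ONLY over v1 = p202633 76092a16f9da; every declaration byte-identical): page locator of (2.16)∕(2.17) corrected p. 15 → p. 16 at
five places (XREAD an3-g24 D1) and the p. 13 gloss completed with p. 14 l. 1 (O1).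
NOT CLAIMED: any walk expansion of Bałaban's operators, any analyticity or majorant of any concrete term (hypotheses `ha`, `hm`, `hsum`); the
identification of `σ` with the cube parameters `s(Δ)`/`σ(Δ)` of [II] §1 and of `κ, d` with `½δ₀, |b₋ − b′₋|`; multi-parameter analyticity (one
line at a time only).  No `def … : Prop`; nothing about Bałaban's `β`-functions is asserted.
PRIOR ART IN THE TREE (searched 2026-08-20; nothing re-derived): `B13PerturbativeStep` (C-B13-13/13a: `WRS`, `WRS.of_majorant`,
`WRS.sub_apply_zero_of_differentiableOn`, `WRS.inv_sub_inv_of_differentiableOn` — BY NAME; its hypothesis is the summed family, supplied here);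
`B10Eq63Rep` (b10-g16: `G3Rep`/`G3Cont`/`G3WalkBound` — representation, CONTINUITY in the real parameter x and x-uniform bounds for the (63)/(2.7)
integral; no analyticity); `B9SectDWalk` (r1-g8: walk-term algebra with finite truncations, no parameters); `T4InputCauchyRateTermwise` (T⁴ lineage:
the same Mathlib M-test for ITS coupling-analytic families — different objects and consumer).  None places the M-test at the `WRS`/(2.16) seam.
-/

open Metric Set Filter Topology
open Literature.MathematicalPhysics.QuantumFieldTheory.Balaban1983to89
open B13PerturbativeStep (WRS WeightHyp)

namespace Summit.QuantumFields.BalabanUV.Beta.AnalyticWalkSum216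

noncomputable section

variable {n : Type*} [Fintype n] {W : Type*}

/-! ## §1. The summed operator: convergence, the uniform majorant, analyticity in `σ` -/

/-- The SUMMED complexified operator, entrywise: `A(σ)_{ij} = Σ_w T_w(σ)_{ij}` over all walk terms. [folklore] -/
def termSum (T : W → ℂ → Matrix n n ℂ) (σ : ℂ) : Matrix n n ℂ := fun i j => ∑' w, T w σ i j

/-- The SUMMED majorant `M_{ij} = Σ_w m_w(i,j)`. [folklore] -/
def majSum (m : W → n → n → ℝ) (i j : n) : ℝ := ∑' w, m w i j

variable {T : W → ℂ → Matrix n n ℂ} {m : W → n → n → ℝ} {R : ℝ}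

omit [Fintype n] in
/-- Absolute convergence: the entrywise walk sums are summable on the disc. [folklore] -/
theorem summable_term (hm : ∀ w, ∀ σ ∈ ball (0 : ℂ) R, ∀ i j, ‖T w σ i j‖ ≤ m w i j)
    (hsum : ∀ i j, Summable fun w => m w i j) {σ : ℂ} (hσ : σ ∈ ball (0 : ℂ) R) (i j : n) :
    Summable fun w => T w σ i j :=
  Summable.of_norm_bounded (hsum i j) fun w => hm w σ hσ i j

omit [Fintype n] in
/-- The entrywise sums CONVERGE to `termSum` (the representation «A = Σ_ω (term)_ω» as a `HasSum`). [folklore] -/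
theorem hasSum_termSum (hm : ∀ w, ∀ σ ∈ ball (0 : ℂ) R, ∀ i j, ‖T w σ i j‖ ≤ m w i j)
    (hsum : ∀ i j, Summable fun w => m w i j) {σ : ℂ} (hσ : σ ∈ ball (0 : ℂ) R) (i j : n) :
    HasSum (fun w => T w σ i j) (termSum T σ i j) :=
  (summable_term hm hsum hσ i j).hasSum

omit [Fintype n] in
/-- **(ii) for the sum**: the summed operator is majorised by the summed majorant, UNIFORMLY on the disc. [folklore] -/
theorem norm_termSum_le (hm : ∀ w, ∀ σ ∈ ball (0 : ℂ) R, ∀ i j, ‖T w σ i j‖ ≤ m w i j)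
    (hsum : ∀ i j, Summable fun w => m w i j) {σ : ℂ} (hσ : σ ∈ ball (0 : ℂ) R) (i j : n) :
    ‖termSum T σ i j‖ ≤ majSum m i j :=
  tsum_of_norm_bounded (hsum i j).hasSum fun w => hm w σ hσ i j

omit [Fintype n] in
/-- **(i) for the sum**: every entry of the summed operator is complex-differentiable on the disc — Weierstrass' M-test + locally uniform limits of
holomorphic functions (Mathlib `Complex.differentiableOn_tsum_of_summable_norm`). [folklore] -/
theorem differentiableOn_termSum (ha : ∀ w i j, DifferentiableOn ℂ (fun σ => T w σ i j) (ball 0 R))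
    (hm : ∀ w, ∀ σ ∈ ball (0 : ℂ) R, ∀ i j, ‖T w σ i j‖ ≤ m w i j) (hsum : ∀ i j, Summable fun w => m w i j) (i j : n) :
    DifferentiableOn ℂ (fun σ => termSum T σ i j) (ball 0 R) :=
  Complex.differentiableOn_tsum_of_summable_norm (hsum i j) (fun w => ha w i j) isOpen_ball fun w σ hσ => hm w σ hσ i j

/-! ## §2. The (2.16)-type bounds for the summed operator and its inverse -/

/-- The value at `σ = 0` is localised with the summed constant: `WRS κ d (termSum T 0) ρ`. [folklore] -/
theorem wrs_termSum_zero {κ : ℝ} {d : n → n → ℝ} {ρ : ℝ} (hR : 0 < R)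
    (hm : ∀ w, ∀ σ ∈ ball (0 : ℂ) R, ∀ i j, ‖T w σ i j‖ ≤ m w i j) (hsum : ∀ i j, Summable fun w => m w i j)
    (hρ : ∀ i, ∑ j, majSum m i j * Real.exp (κ * d i j) ≤ ρ) : WRS κ d (termSum T 0) ρ :=
  B13PerturbativeStep.WRS.of_majorant (fun i j => norm_termSum_le hm hsum (mem_ball_self hR) i j) hρ

/-- **The (2.16)-shape bound for the DIFFERENCE, from per-term data**: per-term analyticity on the disc `‖σ‖ < R` + σ-uniform entrywise majorants
with summable, LOCALISED row sums (`Σ_j (Σ_w m_w(i,j)) e^{κ d(i,j)} ≤ ρ`) ⟹ `WRS κ d (A σ − A 0) (2ρ/R·|σ|)` — the tree's Cauchy step applied to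
the sum, whose two hypotheses §1 supplies. [cite: Balaban1988RG2Cluster, (2.16) p.16] -/
theorem wrs_termSum_sub {κ : ℝ} {d : n → n → ℝ} {ρ : ℝ} (hR : 0 < R)
    (ha : ∀ w i j, DifferentiableOn ℂ (fun σ => T w σ i j) (ball 0 R))
    (hm : ∀ w, ∀ σ ∈ ball (0 : ℂ) R, ∀ i j, ‖T w σ i j‖ ≤ m w i j) (hsum : ∀ i j, Summable fun w => m w i j)
    (hρ : ∀ i, ∑ j, majSum m i j * Real.exp (κ * d i j) ≤ ρ) {σ : ℂ} (hσ : σ ∈ ball (0 : ℂ) R) :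
    WRS κ d (termSum T σ - termSum T 0) (2 * ρ / R * ‖σ‖) :=
  B13PerturbativeStep.WRS.sub_apply_zero_of_differentiableOn hR (differentiableOn_termSum ha hm hsum)
    (fun _ hσ i j => norm_termSum_le hm hsum hσ i j) hρ hσ

/-- **«R₂ satisfying (2.16)» for the inverses, from per-term data**: with moreover `A 0` invertible, `WRS κ d (A 0)⁻¹ K` and `K(2ρ/R)|σ| < 1`,
the difference of inverses obeys `WRS κ d ((A σ)⁻¹ − (A 0)⁻¹) (Kθ(1 − Kθ)⁻¹K)`, `θ = (2ρ/R)|σ|` (`WRS.inv_sub_inv_of_differentiableOn` BY NAME).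
[cite: Balaban1988RG2Cluster, (2.16)–(2.17) p.16] -/
theorem wrs_inv_termSum_sub [DecidableEq n] {κ : ℝ} {d : n → n → ℝ} {ρ K : ℝ} (hw : WeightHyp κ d) (hR : 0 < R)
    (ha : ∀ w i j, DifferentiableOn ℂ (fun σ => T w σ i j) (ball 0 R))
    (hm : ∀ w, ∀ σ ∈ ball (0 : ℂ) R, ∀ i j, ‖T w σ i j‖ ≤ m w i j) (hsum : ∀ i j, Summable fun w => m w i j)
    (hρ : ∀ i, ∑ j, majSum m i j * Real.exp (κ * d i j) ≤ ρ) (hM : IsUnit (termSum T 0)) (hK : WRS κ d (termSum T 0)⁻¹ K)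
    {σ : ℂ} (hσ : σ ∈ ball (0 : ℂ) R) (hsmall : K * (2 * ρ / R * ‖σ‖) < 1) :
    WRS κ d ((termSum T σ)⁻¹ - (termSum T 0)⁻¹) (K * (2 * ρ / R * ‖σ‖) * (1 - K * (2 * ρ / R * ‖σ‖))⁻¹ * K) :=
  B13PerturbativeStep.WRS.inv_sub_inv_of_differentiableOn hw hR (differentiableOn_termSum ha hm hsum)
    (fun _ hσ i j => norm_termSum_le hm hsum hσ i j) hρ hM hK hσ hsmall

/-! ## §3. The localised row-sum hypothesis from TERMWISE localised row sums -/

/-- **Tonelli for the row sums**: if every walk term is localised with its own constant, `Σ_j m_w(i,j) e^{κ d(i,j)} ≤ ρ_w`, the majorants are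
summable entrywise, and the constants are summable with `Σ_w ρ_w ≤ ρ` (for a (3.108)-type family: `ρ_w` geometric in `|ω|`),
then the summed majorant is localised with constant `ρ`: `Σ_j (Σ_w m_w(i,j)) e^{κ d(i,j)} ≤ ρ` (no sign condition needed). [folklore] -/
theorem majSum_row_le_of_termwise {κ : ℝ} {d : n → n → ℝ} {ρw : W → ℝ} {ρ : ℝ} (hsum : ∀ i j, Summable fun w => m w i j) (hrow : ∀ w i, ∑ j, m w i j * Real.exp (κ * d i j) ≤ ρw w)
    (hρw : Summable ρw) (hρ : ∑' w, ρw w ≤ ρ) (i : n) : ∑ j, majSum m i j * Real.exp (κ * d i j) ≤ ρ := by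
  have hsum' : ∀ j, Summable fun w => m w i j * Real.exp (κ * d i j) := fun j => (hsum i j).mul_right _
  have hswap : ∑ j, majSum m i j * Real.exp (κ * d i j) = ∑' w, ∑ j, m w i j * Real.exp (κ * d i j) := by
    simp only [majSum]
    rw [Summable.tsum_finsetSum (fun j _ => hsum' j)]
    exact Finset.sum_congr rfl fun j _ => (Summable.tsum_mul_right _ (hsum i j)).symm
  rw [hswap]
  have hle : ∑' w, ∑ j, m w i j * Real.exp (κ * d i j) ≤ ∑' w, ρw w :=
    Summable.tsum_le_tsum (fun w => hrow w i) (summable_sum fun j _ => hsum' j) hρw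
  exact hle.trans hρ

/-- The same packaged with §2: per-term analyticity + per-term majorants + TERMWISE localised row sums with summable constants ⟹ the
(2.16)-shape bound for the summed difference. [cite: Balaban1988RG2Cluster, (2.16) p.16] -/
theorem wrs_termSum_sub_of_termwise {κ : ℝ} {d : n → n → ℝ} {ρw : W → ℝ} {ρ : ℝ} (hR : 0 < R)
    (ha : ∀ w i j, DifferentiableOn ℂ (fun σ => T w σ i j) (ball 0 R))
    (hm : ∀ w, ∀ σ ∈ ball (0 : ℂ) R, ∀ i j, ‖T w σ i j‖ ≤ m w i j) (hsum : ∀ i j, Summable fun w => m w i j)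
    (hrow : ∀ w i, ∑ j, m w i j * Real.exp (κ * d i j) ≤ ρw w) (hρw : Summable ρw) (hρ : ∑' w, ρw w ≤ ρ)
    {σ : ℂ} (hσ : σ ∈ ball (0 : ℂ) R) : WRS κ d (termSum T σ - termSum T 0) (2 * ρ / R * ‖σ‖) :=
  wrs_termSum_sub hR ha hm hsum (majSum_row_le_of_termwise hsum hrow hρw hρ) hσ

/-! ## §4. Non-vacuity -/

/-- The hypothesis set of `wrs_termSum_sub_of_termwise` is inhabited: one bond, one walk term `T(σ) = σ` on the unit disc, majorant `1`,
trivial distance, `ρ = 1`. [folklore] -/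
example : WRS (n := Unit) 0 (fun _ _ => 0)
    (termSum (fun (_ : Unit) (σ : ℂ) => fun _ _ => σ) (1 / 2) - termSum (fun (_ : Unit) (σ : ℂ) => fun _ _ => σ) 0)
    (2 * 1 / 1 * ‖(1 / 2 : ℂ)‖) := by
  refine wrs_termSum_sub_of_termwise (m := fun _ _ _ => (1 : ℝ)) (ρw := fun _ => (1 : ℝ)) one_pos (fun _ _ _ => differentiableOn_id)
    (fun _ σ hσ _ _ => (mem_ball_zero_iff.1 hσ).le) (fun _ _ => .of_finite) (fun _ _ => by simp) .of_finite (by simp) ?_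
  rw [mem_ball_zero_iff]; norm_num

end

end Summit.QuantumFields.BalabanUV.Beta.AnalyticWalkSum216
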